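/-
Copyright: the b2b-balaban T⁴-continuum CRUX team, row NE7b OWNER lineage `t4-ne7b-p1` (gen 130). Project licence.
-/
import Summits.QuantumFields.BalabanUV.T4Continuum.Spine.NE7b.SupEffectiveActionCovariance

/-!
# THE TILTED VARIANCE OF THE REMAINDERS' GRADIENT IS BOUNDED BY THEIR SECOND-ORDER CONSTANTS: for `C²` remainders with
# `|w''| ≤ κ₂` and the lower letter of constant `λ_w` (`2λ_w ≤ m`, `m` the floor of the precision `M`), at EVERY external field `ψ₀`
# and every direction `v`, with `ν = e^{−V(ψ₀,·)}N(0,M⁻¹)∕Z(ψ₀)`,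
#   `Var_ν(Σ_{p∈C}Σ_{x∈cell p}w_x'(ω_x+ψ₀,x)v_x) ≤ (κ₂ + 2λ_w)·Σ_{p∈C}Σ_{x∈cell p}v_x²`
# — the covariance formula of (320) (`Var_ν(Dv) = ⟨D₂vv⟩_ν − Hess(−log Z)[v,v]`) with `⟨D₂vv⟩_ν ≤ κ₂Q(v)` and the lower letter read on
# the Hessian (`Hess[v,v] ≥ −2λ_wQ(v)`, (320) §3); uniform in the volume and in `ψ₀`, NO smallness used (row NE7b, node U5c; (319)∕(320)
# BY NAME; [folklore])

Cell `pub-balaban`, sub-cell `t4`, spine estimate NE7b (`T4WeightBudget.RelWeightBound`; the cell's OWN estimate — NOT PRINTED in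
[Bałaban 1983–89], NOT PROVED).  Crux-route work under `Spine/NE7b/` by the row OWNER (`t4-ne7b-p1` gen 130, file (321)) under FREEZE
(0)'s crux-prover clause, on § [NE7bP1-G129-HANDOFF] NEXT (i) («Brascamp–Lieb variance bound now has both letters available»); NOTHING
of Bałaban's is named as a Lean object, valued or asserted; no `T4Continuum/Support` leaf typed; no `def`, no notation; zero `sorry`.
Imports (BY NAME): the OWNER's (320) `…SupEffectiveActionCovariance` (`integrable_weightedCellHess`, `hessian_neg_log_step_apply`,
`hessian_neg_log_step_ge`), (319) (`cellHess_apply`, `smulRight_cellDeriv_apply`), (313) (`mul_opBound_le_of_le`), (306)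
(`cellSum_eq_sum_biUnion`), (297) (`integrable_exp_neg`); Mathlib's `Integrable.mul_bdd`, `ContinuousLinearMap.integral_apply` (through
`Integrable` of the applied integrand), `integral_sub`, `integral_mono`, `integral_exp_pos`.

WHY (located).  The cluster-expansion side of the iteration ((312), and the `O(ε)` covariance bound the successor owes) manipulates
truncated two-point functions of the tilted law `ν`; before any smallness, the road must know that the fluctuation covariance of the
remainders' gradient `D_ψV·v = Σw'_xv_x` is FINITE and VOLUME-UNIFORM per unit gauge `Q(v) = Σv_x²`.  That is exactly what the two
second-order constants give through (320): `Var_ν(Dv) = ⟨Σw''v²⟩_ν − Hess[v,v] ≤ κ₂Q(v) + 2λ_wQ(v)`.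

WHAT IS PROVED ([folklore]; notation of (319)∕(320) with `Γ = M⁻¹`, `M ≻ 0`):
* §1 `abs_cellHess_apply_le` (`|Σw''v_xv_x| ≤ κ₂Q(v)`), `integrable_exp_neg_mul_cellHess`, `integrable_exp_neg_mul_sq`
  (`e^{−V}(Σw'v)²` is integrable — difference of (320)'s weighted Hessian applied twice and the bounded term), `integral_exp_neg_mul_cellHess_le`
  (`∫e^{−V}Σw''v² ≤ κ₂Q(v)·Z`);
* §2 THE END **`tilted_variance_le`**: `Z⁻¹∫e^{−V}(Σw'v)²dμ − (Z⁻¹∫e^{−V}Σw'v dμ)² ≤ (κ₂ + 2λ_w)·Q(v)` at EVERY `ψ₀, v`; §3 toy.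

HONEST (what this is NOT).  An `O(1)` bound, not the `O(ε)` covariance bound of the expansion and not Brascamp–Lieb's
`⟨∇g·(Hess)⁻¹∇g⟩_ν`; the variance of the LINEAR functional `Dv` of the gradient only (general observables are not typed); positive-definite
covariance ((318)'s dictionary); scalar skeleton ((A3), NC-NE7b-α UNRULED); nothing of Bałaban's asserted.  BY-NAME EFFECT ON THE WALL:
NONE.  NE7b NOT PRINTED ∕ NOT PROVED; spine PROVED 0∕9; rung (B)+1 — the programme's measures remain FINITE-torus statements; NOT the mass
gap, NOT Clay.  HONEST DEPENDENCY: continuum YM on T⁴ ⇐ BetaPertH ∧ nine spine estimates (0∕9 proved); BetaPertH ⇐ (D1) ∧ (D4) ∧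
CAP+tail; G-an2-4 gates asym, D1 and NE2∕3∕4.
-/

set_option autoImplicit false
set_option maxSynthPendingDepth 2

noncomputable section

namespace Summit.QuantumFields.BalabanUV.T4Continuum.NE7b.SupTiltedVarianceBound

open MeasureTheory ProbabilityTheory Finset Real
open scoped BigOperators Matrix
open SupEffectiveActionCovariance (integrable_weightedCellHess hessian_neg_log_step_apply hessian_neg_log_step_ge)
open SupEffectiveActionHessian (cellHess_apply smulRight_cellDeriv_apply)
open SupEffectiveActionDerivative (mul_opBound_le_of_le)
open SupSmallFieldGasReal (measurable_cellSum cellSum_eq_sum_biUnion)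
open SupFluctuationAPriori (integrable_exp_neg)

variable {ι : Type} [Fintype ι] [DecidableEq ι] {V : Type*}

/-! ## §1. The second-derivative term is bounded; the square term is integrable -/

omit [Fintype ι] [DecidableEq ι] in
/-- `|w''_x(t)| ≤ κ₂ ⟹ |Σ_{p∈C}Σ_{x∈cell p}w''_x(ω_x+ψ_x)v_xv_x| ≤ κ₂·Σ_{p∈C}Σ_{x∈cell p}v_x²`. [folklore] -/
theorem abs_cellHess_apply_le (cell : V → Finset ι) {w'' : ι → ℝ → ℝ} {κ₂ : ℝ} (hw''b : ∀ x t, |w'' x t| ≤ κ₂) (C : Finset V)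
    (ω ψ v : ι → ℝ) :
    |∑ p ∈ C, ∑ x ∈ cell p, w'' x (ω x + ψ x) * v x * v x| ≤ κ₂ * ∑ p ∈ C, ∑ x ∈ cell p, v x ^ 2 := by
  rw [mul_sum]
  refine (abs_sum_le_sum_abs _ _).trans (sum_le_sum fun p _ => ?_)
  rw [mul_sum]
  refine (abs_sum_le_sum_abs _ _).trans (sum_le_sum fun x _ => ?_)
  have e : w'' x (ω x + ψ x) * v x * v x = w'' x (ω x + ψ x) * v x ^ 2 := by ring
  rw [e, abs_mul, abs_of_nonneg (sq_nonneg (v x))]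
  exact mul_le_mul_of_nonneg_right (hw''b x _) (sq_nonneg _)

section Main

variable {M : Matrix ι ι ℝ} {γop m lamw : ℝ} {cell : V → Finset ι} {w w' w'' : ι → ℝ → ℝ} {κ₀ κ₁ κ₂ τ δ θ : ℝ}

/-- **`e^{−V}·Σw''v_xv_x` is integrable** under `N(0,Γ)` (`Γ ⪰ 0`, `Γ ⪯ γ_op·1`, stability, `2κ₀(1+τ)γ_op ≤ θ < 1`, `|w''| ≤ κ₂` measurable):
an integrable factor times a bounded measurable one. [folklore] -/
theorem integrable_exp_neg_mul_cellHess {Γ : Matrix ι ι ℝ} (hΓ : Γ.PosSemidef) (hΓop : (γop • (1 : Matrix ι ι ℝ) - Γ).PosSemidef)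
    (hdisj : ∀ p q, p ≠ q → Disjoint (cell p) (cell q)) (hw : ∀ x, Measurable (w x)) (hw''m : ∀ x, Measurable (w'' x))
    (hκ₀ : 0 ≤ κ₀) (hτ : 0 < τ) (hθ1 : θ < 1) (hκθ₀ : 2 * κ₀ * (1 + τ) * γop ≤ θ) (hstab : ∀ x, ∀ t : ℝ, -(κ₀ * t ^ 2) ≤ w x t)
    (hw''b : ∀ x t, |w'' x t| ≤ κ₂) (C : Finset V) (ψ₀ v : EuclideanSpace ℝ ι) :
    Integrable (fun ω : EuclideanSpace ℝ ι => exp (-(∑ p ∈ C, ∑ x ∈ cell p, w x (ω x + ψ₀ x))) *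
      (∑ p ∈ C, ∑ x ∈ cell p, w'' x (ω x + ψ₀ x) * v x * v x)) (multivariateGaussian 0 Γ) := by
  have hI : Integrable (fun ω : EuclideanSpace ℝ ι => exp (-(∑ p ∈ C, ∑ x ∈ cell p, w x (ω x + ψ₀ x))))
      (multivariateGaussian 0 Γ) := by
    have h := integrable_exp_neg hΓ hΓop (C.biUnion cell) w hw hκ₀ hτ hθ1 hκθ₀ hstab (fun x => ψ₀ x)
    refine h.congr (ae_of_all _ fun ω => ?_)
    simp only
    rw [cellSum_eq_sum_biUnion cell hdisj C]
  have hmeas : Measurable fun ω : EuclideanSpace ℝ ι => ∑ p ∈ C, ∑ x ∈ cell p, w'' x (ω x + ψ₀ x) * v x * v x := by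
    refine Finset.measurable_sum C fun p _ => Finset.measurable_sum (cell p) fun x _ => ?_
    exact (((hw''m x).comp ((by fun_prop : Measurable fun ω : EuclideanSpace ℝ ι => ω x).add_const (ψ₀ x))).mul_const _).mul_const _
  refine hI.mul_bdd (c := κ₂ * ∑ p ∈ C, ∑ x ∈ cell p, v x ^ 2) hmeas.aestronglyMeasurable (ae_of_all _ fun ω => ?_)
  rw [Real.norm_eq_abs]
  exact abs_cellHess_apply_le cell hw''b C (fun x => ω x) (fun x => ψ₀ x) (fun x => v x)

/-- **`e^{−V}·(Σw'v)²` IS INTEGRABLE**: the weighted second derivative `e^{−V}•(D₂ − D⊗D)` of (319)∕(320) is Bochner integrable, so its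
double evaluation `e^{−V}(Σw''v² − (Σw'v)²)` is, and `e^{−V}Σw''v²` is (bounded factor): subtract. [folklore] -/
theorem integrable_exp_neg_mul_sq {Γ : Matrix ι ι ℝ} (hΓ : Γ.PosSemidef) (hΓop : (γop • (1 : Matrix ι ι ℝ) - Γ).PosSemidef)
    (hdisj : ∀ p q, p ≠ q → Disjoint (cell p) (cell q)) (hw' : ∀ x t, HasDerivAt (w x) (w' x t) t) (hw'm : ∀ x, Measurable (w' x))
    (hw''m : ∀ x, Measurable (w'' x)) (hκ₀ : 0 ≤ κ₀) (hκ₁ : 0 ≤ κ₁) (hτ : 0 < τ) (hδ : 0 < δ) (hθ0 : 0 < θ) (hθ1 : θ < 1)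
    (hκθ : (2 * κ₀ * (1 + τ) + 4 * δ) * γop ≤ θ) (hstab : ∀ x, ∀ t : ℝ, -(κ₀ * t ^ 2) ≤ w x t) (hw'b : ∀ x t, |w' x t| ≤ κ₁ * |t|)
    (hw''b : ∀ x t, |w'' x t| ≤ κ₂) (C : Finset V) (ψ₀ v : EuclideanSpace ℝ ι) :
    Integrable (fun ω : EuclideanSpace ℝ ι => exp (-(∑ p ∈ C, ∑ x ∈ cell p, w x (ω x + ψ₀ x))) *
      ((∑ p ∈ C, ∑ x ∈ cell p, w' x (ω x + ψ₀ x) * v x) * (∑ p ∈ C, ∑ x ∈ cell p, w' x (ω x + ψ₀ x) * v x)))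
      (multivariateGaussian 0 Γ) := by
  have hw : ∀ x, Measurable (w x) := fun x => (continuous_iff_continuousAt.2 fun t => (hw' x t).continuousAt).measurable
  have hκθ₀ : 2 * κ₀ * (1 + τ) * γop ≤ θ := mul_opBound_le_of_le (by positivity) (by linarith) hθ0.le hκθ
  have hA := integrable_exp_neg_mul_cellHess hΓ hΓop hdisj hw hw''m hκ₀ hτ hθ1 hκθ₀ hstab hw''b C ψ₀ v
  have hHint := integrable_weightedCellHess hΓ hΓop hdisj hw' hw'm hw''m hκ₀ hκ₁ hτ hδ hθ1 hκθ hstab hw'b hw''b C ψ₀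
  have hAB : Integrable (fun ω : EuclideanSpace ℝ ι => exp (-(∑ p ∈ C, ∑ x ∈ cell p, w x (ω x + ψ₀ x))) *
      (∑ p ∈ C, ∑ x ∈ cell p, w'' x (ω x + ψ₀ x) * v x * v x -
        (∑ p ∈ C, ∑ x ∈ cell p, w' x (ω x + ψ₀ x) * v x) * (∑ p ∈ C, ∑ x ∈ cell p, w' x (ω x + ψ₀ x) * v x)))
      (multivariateGaussian 0 Γ) := by
    have h := (ContinuousLinearMap.apply ℝ ℝ v).integrable_comp
      ((ContinuousLinearMap.apply ℝ (EuclideanSpace ℝ ι →L[ℝ] ℝ) v).integrable_comp hHint)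
    refine h.congr (ae_of_all _ fun ω => ?_)
    simp only [ContinuousLinearMap.apply_apply, _root_.smul_apply, _root_.sub_apply, smul_eq_mul, cellHess_apply,
      smulRight_cellDeriv_apply]
  refine (hA.sub hAB).congr (ae_of_all _ fun ω => ?_)
  simp only [Pi.sub_apply]
  ring

/-- **The second-derivative term under the tilted numerator**: `∫e^{−V}Σw''v_xv_x dμ ≤ κ₂Q(v)·∫e^{−V}dμ`. [folklore] -/
theorem integral_exp_neg_mul_cellHess_le {Γ : Matrix ι ι ℝ} (hΓ : Γ.PosSemidef) (hΓop : (γop • (1 : Matrix ι ι ℝ) - Γ).PosSemidef)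
    (hdisj : ∀ p q, p ≠ q → Disjoint (cell p) (cell q)) (hw : ∀ x, Measurable (w x)) (hw''m : ∀ x, Measurable (w'' x))
    (hκ₀ : 0 ≤ κ₀) (hτ : 0 < τ) (hθ1 : θ < 1) (hκθ₀ : 2 * κ₀ * (1 + τ) * γop ≤ θ) (hstab : ∀ x, ∀ t : ℝ, -(κ₀ * t ^ 2) ≤ w x t)
    (hw''b : ∀ x t, |w'' x t| ≤ κ₂) (C : Finset V) (ψ₀ v : EuclideanSpace ℝ ι) :
    ∫ ω : EuclideanSpace ℝ ι, exp (-(∑ p ∈ C, ∑ x ∈ cell p, w x (ω x + ψ₀ x))) *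
        (∑ p ∈ C, ∑ x ∈ cell p, w'' x (ω x + ψ₀ x) * v x * v x) ∂(multivariateGaussian 0 Γ) ≤
      κ₂ * (∑ p ∈ C, ∑ x ∈ cell p, v x ^ 2) *
        ∫ ω : EuclideanSpace ℝ ι, exp (-(∑ p ∈ C, ∑ x ∈ cell p, w x (ω x + ψ₀ x))) ∂(multivariateGaussian 0 Γ) := by
  have hI : Integrable (fun ω : EuclideanSpace ℝ ι => exp (-(∑ p ∈ C, ∑ x ∈ cell p, w x (ω x + ψ₀ x))))
      (multivariateGaussian 0 Γ) := by
    have h := integrable_exp_neg hΓ hΓop (C.biUnion cell) w hw hκ₀ hτ hθ1 hκθ₀ hstab (fun x => ψ₀ x)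
    refine h.congr (ae_of_all _ fun ω => ?_)
    simp only
    rw [cellSum_eq_sum_biUnion cell hdisj C]
  have hA := integrable_exp_neg_mul_cellHess hΓ hΓop hdisj hw hw''m hκ₀ hτ hθ1 hκθ₀ hstab hw''b C ψ₀ v
  rw [mul_comm (κ₂ * _), ← integral_mul_const]
  refine integral_mono hA (hI.mul_const _) fun ω => ?_
  have h := (le_abs_self _).trans (abs_cellHess_apply_le cell hw''b C (fun x => ω x) (fun x => ψ₀ x) (fun x => v x))
  exact mul_le_mul_of_nonneg_left h (exp_pos _).le

/-! ## §2. THE END: the tilted variance of the gradient is bounded by the second-order constants -/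

/-- **THE END — THE TILTED VARIANCE OF THE REMAINDERS' GRADIENT IS AT MOST `(κ₂ + 2λ_w)Q(v)`.**  `M ≻ 0` with floor `m·Σz² ≤ ⟨z,Mz⟩`
and `M⁻¹ ⪯ γ_op·1`; pairwise disjoint cells; `w_x ∈ C²` with `w'_x, w''_x` measurable, `|w'_x(t)| ≤ κ₁|t|` (`κ₁ ≥ 0`), `|w''_x(t)| ≤ κ₂`,
`−κ₀t² ≤ w_x(t)` (`κ₀ ≥ 0`), the lower letter `w_x(a) + w'_x(a)(b−a) − ½λ_w(b−a)² ≤ w_x(b)` (`λ_w ≥ 0`, `2λ_w ≤ m`); `0 < τ`, `0 < δ`,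
`0 < θ < 1`, `(2κ₀(1+τ)+4δ)γ_op ≤ θ` ⟹ at EVERY `ψ₀, v`, with `Z = ∫e^{−V(ψ₀,ω)}dN(0,M⁻¹)`, `B(ω) = Σ_{p∈C}Σ_{x∈cell p}w'_x(ω_x+ψ₀,x)v_x`:
`Z⁻¹∫e^{−V}B² − (Z⁻¹∫e^{−V}B)² ≤ (κ₂ + 2λ_w)·Σ_{p∈C}Σ_{x∈cell p}v_x²`. [folklore] -/
theorem tilted_variance_le (hM : M.PosDef) (hfl : ∀ z : ι → ℝ, m * ∑ i, z i ^ 2 ≤ z ⬝ᵥ (M *ᵥ z))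
    (hΓop : (γop • (1 : Matrix ι ι ℝ) - M⁻¹).PosSemidef) (hdisj : ∀ p q, p ≠ q → Disjoint (cell p) (cell q))
    (hw' : ∀ x t, HasDerivAt (w x) (w' x t) t) (hw'' : ∀ x t, HasDerivAt (w' x) (w'' x t) t) (hw'm : ∀ x, Measurable (w' x))
    (hw''m : ∀ x, Measurable (w'' x)) (hκ₀ : 0 ≤ κ₀) (hκ₁ : 0 ≤ κ₁) (hτ : 0 < τ) (hδ : 0 < δ) (hθ0 : 0 < θ) (hθ1 : θ < 1)
    (hκθ : (2 * κ₀ * (1 + τ) + 4 * δ) * γop ≤ θ) (hstab : ∀ x, ∀ t : ℝ, -(κ₀ * t ^ 2) ≤ w x t) (hw'b : ∀ x t, |w' x t| ≤ κ₁ * |t|)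
    (hw''b : ∀ x t, |w'' x t| ≤ κ₂) (hlamw : 0 ≤ lamw) (hwlo : ∀ u (a b : ℝ), w u a + w' u a * (b - a) - lamw / 2 * (b - a) ^ 2 ≤ w u b)
    (hm : 2 * lamw ≤ m) (C : Finset V) (ψ₀ v : EuclideanSpace ℝ ι) :
    (∫ ω : EuclideanSpace ℝ ι, exp (-(∑ p ∈ C, ∑ x ∈ cell p, w x (ω x + ψ₀ x))) ∂(multivariateGaussian 0 M⁻¹))⁻¹ *
          ∫ ω : EuclideanSpace ℝ ι, exp (-(∑ p ∈ C, ∑ x ∈ cell p, w x (ω x + ψ₀ x))) *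
            ((∑ p ∈ C, ∑ x ∈ cell p, w' x (ω x + ψ₀ x) * v x) * (∑ p ∈ C, ∑ x ∈ cell p, w' x (ω x + ψ₀ x) * v x))
            ∂(multivariateGaussian 0 M⁻¹) -
        ((∫ ω : EuclideanSpace ℝ ι, exp (-(∑ p ∈ C, ∑ x ∈ cell p, w x (ω x + ψ₀ x))) ∂(multivariateGaussian 0 M⁻¹))⁻¹ *
          ∫ ω : EuclideanSpace ℝ ι, exp (-(∑ p ∈ C, ∑ x ∈ cell p, w x (ω x + ψ₀ x))) *
            (∑ p ∈ C, ∑ x ∈ cell p, w' x (ω x + ψ₀ x) * v x) ∂(multivariateGaussian 0 M⁻¹)) ^ 2 ≤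
      (κ₂ + 2 * lamw) * ∑ p ∈ C, ∑ x ∈ cell p, v x ^ 2 := by
  have hΓ : (M⁻¹).PosSemidef := hM.inv.posSemidef
  have hw : ∀ x, Measurable (w x) := fun x => (continuous_iff_continuousAt.2 fun t => (hw' x t).continuousAt).measurable
  have hκθ₀ : 2 * κ₀ * (1 + τ) * γop ≤ θ := mul_opBound_le_of_le (by positivity) (by linarith) hθ0.le hκθ
  -- `Z > 0`
  have hI : Integrable (fun ω : EuclideanSpace ℝ ι => exp (-(∑ p ∈ C, ∑ x ∈ cell p, w x (ω x + ψ₀ x))))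
      (multivariateGaussian 0 M⁻¹) := by
    have h := integrable_exp_neg hΓ hΓop (C.biUnion cell) w hw hκ₀ hτ hθ1 hκθ₀ hstab (fun x => ψ₀ x)
    refine h.congr (ae_of_all _ fun ω => ?_)
    simp only
    rw [cellSum_eq_sum_biUnion cell hdisj C]
  have hZ : 0 < ∫ ω : EuclideanSpace ℝ ι, exp (-(∑ p ∈ C, ∑ x ∈ cell p, w x (ω x + ψ₀ x))) ∂(multivariateGaussian 0 M⁻¹) :=
    integral_exp_pos hI
  -- the lower letter read on the Hessian, then through the covariance formula
  have hlow := hessian_neg_log_step_ge hM hfl hΓop hdisj hw' hw'' hw'm hw''m hκ₀ hκ₁ hτ hδ hθ0 hθ1 hκθ hstab hw'b hw''b hlamw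
    hwlo hm C ψ₀ v
  rw [hessian_neg_log_step_apply hΓ hΓop hdisj hw' hw'm hw''m hκ₀ hκ₁ hτ hδ hθ1 hκθ hstab hw'b hw''b C ψ₀ v v] at hlow
  -- split the mixed integral
  have hA := integrable_exp_neg_mul_cellHess hΓ hΓop hdisj hw hw''m hκ₀ hτ hθ1 hκθ₀ hstab hw''b C ψ₀ v
  have hB := integrable_exp_neg_mul_sq hΓ hΓop hdisj hw' hw'm hw''m hκ₀ hκ₁ hτ hδ hθ0 hθ1 hκθ hstab hw'b hw''b C ψ₀ v
  have hsplit : ∫ ω : EuclideanSpace ℝ ι, exp (-(∑ p ∈ C, ∑ x ∈ cell p, w x (ω x + ψ₀ x))) *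
      (∑ p ∈ C, ∑ x ∈ cell p, w'' x (ω x + ψ₀ x) * v x * v x -
        (∑ p ∈ C, ∑ x ∈ cell p, w' x (ω x + ψ₀ x) * v x) * (∑ p ∈ C, ∑ x ∈ cell p, w' x (ω x + ψ₀ x) * v x))
      ∂(multivariateGaussian 0 M⁻¹) =
      ∫ ω : EuclideanSpace ℝ ι, exp (-(∑ p ∈ C, ∑ x ∈ cell p, w x (ω x + ψ₀ x))) *
        (∑ p ∈ C, ∑ x ∈ cell p, w'' x (ω x + ψ₀ x) * v x * v x) ∂(multivariateGaussian 0 M⁻¹) -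
      ∫ ω : EuclideanSpace ℝ ι, exp (-(∑ p ∈ C, ∑ x ∈ cell p, w x (ω x + ψ₀ x))) *
        ((∑ p ∈ C, ∑ x ∈ cell p, w' x (ω x + ψ₀ x) * v x) * (∑ p ∈ C, ∑ x ∈ cell p, w' x (ω x + ψ₀ x) * v x))
        ∂(multivariateGaussian 0 M⁻¹) := by
    rw [← integral_sub hA hB]
    exact integral_congr_ae (ae_of_all _ fun ω => by simp only [mul_sub])
  rw [hsplit] at hlow
  -- the second-derivative term is at most `κ₂Q(v)·Z`
  have hAle := integral_exp_neg_mul_cellHess_le hΓ hΓop hdisj hw hw''m hκ₀ hτ hθ1 hκθ₀ hstab hw''b C ψ₀ v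
  have hAle' : (∫ ω : EuclideanSpace ℝ ι, exp (-(∑ p ∈ C, ∑ x ∈ cell p, w x (ω x + ψ₀ x))) ∂(multivariateGaussian 0 M⁻¹))⁻¹ *
      ∫ ω : EuclideanSpace ℝ ι, exp (-(∑ p ∈ C, ∑ x ∈ cell p, w x (ω x + ψ₀ x))) *
        (∑ p ∈ C, ∑ x ∈ cell p, w'' x (ω x + ψ₀ x) * v x * v x) ∂(multivariateGaussian 0 M⁻¹) ≤
      κ₂ * ∑ p ∈ C, ∑ x ∈ cell p, v x ^ 2 := by
    rw [inv_mul_le_iff₀ hZ]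
    linarith
  -- algebra: `Z⁻¹∫e^{−V}B² − (Z⁻¹∫e^{−V}B)² = Z⁻¹∫e^{−V}Σw''v² − Hess[v,v] ≤ κ₂Q + 2λ_wQ`
  have hsq : ((∫ ω : EuclideanSpace ℝ ι, exp (-(∑ p ∈ C, ∑ x ∈ cell p, w x (ω x + ψ₀ x))) ∂(multivariateGaussian 0 M⁻¹))⁻¹ *
      ∫ ω : EuclideanSpace ℝ ι, exp (-(∑ p ∈ C, ∑ x ∈ cell p, w x (ω x + ψ₀ x))) *
        (∑ p ∈ C, ∑ x ∈ cell p, w' x (ω x + ψ₀ x) * v x) ∂(multivariateGaussian 0 M⁻¹)) ^ 2 =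
      ((∫ ω : EuclideanSpace ℝ ι, exp (-(∑ p ∈ C, ∑ x ∈ cell p, w x (ω x + ψ₀ x))) ∂(multivariateGaussian 0 M⁻¹)) ^ 2)⁻¹ *
        ((∫ ω : EuclideanSpace ℝ ι, exp (-(∑ p ∈ C, ∑ x ∈ cell p, w x (ω x + ψ₀ x))) *
            (∑ p ∈ C, ∑ x ∈ cell p, w' x (ω x + ψ₀ x) * v x) ∂(multivariateGaussian 0 M⁻¹)) *
          ∫ ω : EuclideanSpace ℝ ι, exp (-(∑ p ∈ C, ∑ x ∈ cell p, w x (ω x + ψ₀ x))) *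
            (∑ p ∈ C, ∑ x ∈ cell p, w' x (ω x + ψ₀ x) * v x) ∂(multivariateGaussian 0 M⁻¹)) := by
    ring
  rw [hsq]
  linarith [hlow, hAle']

end Main

/-! ## §3. Toy -/

/-- Toy (§1): the ZERO second derivative has `|Σ0·v·v| ≤ 0·Q(v)`. -/
example (cell : Unit → Finset (Fin 2)) (ω ψ v : Fin 2 → ℝ) :
    |∑ p ∈ ({()} : Finset Unit), ∑ x ∈ cell p, (fun (_ : Fin 2) (_ : ℝ) => (0 : ℝ)) x (ω x + ψ x) * v x * v x| ≤
      0 * ∑ p ∈ ({()} : Finset Unit), ∑ x ∈ cell p, v x ^ 2 :=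
  abs_cellHess_apply_le cell (w'' := fun _ _ => 0) (fun _ _ => by simp) {()} ω ψ v

end Summit.QuantumFields.BalabanUV.T4Continuum.NE7b.SupTiltedVarianceBound
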